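import Mathlib.Geometry.Manifold.Instances.Sphere
import Mathlib.Geometry.Manifold.SmoothEmbedding
import Mathlib.Geometry.Manifold.MFDeriv.Basic
import Mathlib.Topology.Homotopy.Basic
import Literature.Topology.FourManifolds.Isotopy
import Literature.Geometry.Manifold.EmbeddingRangeDiffeomorph
import HarnessLib

/-!
# Gabai's 4-dimensional light bulb theorem in `S² × S²`

Topic `Literature/Topology/FourManifolds`. NAMED FACT (D-0014), no proofs.

D. Gabai, *The 4-dimensional light bulb theorem*, J. Amer. Math. Soc. **33** (2020), 609–652
(arXiv:1705.09989) [Gabai2020]. The paper "works in the smooth category" (p. 3). Verbatim (p. 3,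
Theorem 1.9 = Theorem 10.8 on p. 23, "an immediate consequence of our main result"):

> **Theorem 1.9 (4D-Lightbulb Theorem).** If `R` is an embedded 2-sphere in `S² × S²`,
> homologous to `x₀ × S²`, that intersects `S² × y₀` transversely and only at the point
> `(x₀, y₀)`, then `R` is isotopic to `x₀ × S²` via an isotopy fixing `S² × y₀` pointwise.

(Litherland 1985 [Li there]: a diffeomorphism pseudo-isotopic to the identity taking `R` to
`x₀ × S²`.)

## The Lean form

`S² × S²` is Mathlib's `Metric.sphere (0 : EuclideanSpace ℝ (Fin 3)) 1` squared with the product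
`C^∞` structure `(𝓡 2).prod (𝓡 2)` (the model of route `SmoothPoincare4/ThreeFibres`). The sphere
`R` is the range of a `C^∞` embedding `g : S² → S² × S²` (`Manifold.IsSmoothEmbedding`);
"homologous to `x₀ × S²`" is assumed in the STRONGER form used by the route — `g` is homotopic, as
a continuous map, to a fibre inclusion `p ↦ (x, p)` (homotopic maps are homologous; all fibre
inclusions are homotopic); "intersects `S² × y₀` transversely and only at `(x₀, y₀)`" is: exactly
one `p₀` with `(g p₀).2 = y₀`, and `d(pr₂ ∘ g)` surjective there (transversality to the
horizontal sphere `S² × {y₀} = pr₂⁻¹(y₀)`, whose tangent space is `ker d pr₂`). The conclusion is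
stated through the tree's `Literature.Topology.FourManifolds.AmbientIsotopy` (a jointly smooth
family of diffeomorphisms `F t` of `S² × S²` with `F 0 = id`, `Isotopy.lean`): some ambient
isotopy carries the SET `R = range g` onto the fibre `{x₀} × S²` through `g p₀ = (x₀, y₀)` at
time `1` and fixes `S² × {y₀}` pointwise at all times. (An isotopy of the compact submanifold `R`
fixing `S² × y₀` pointwise is an ambient statement; the unparametrised set form is what is
printed — the parametrised form `F 1 ∘ g = (x₀, ·) ∘ σ` with `σ ∈ Diff(S²)` isotopic to `id`
needs Smale 1959 on top and is NOT asserted.)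

Consumer: route `SmoothPoincare4/ThreeFibres`, support item
`Summit.SmoothPoincare4.SmoothPoincare4.Theses.ThreeFibres.LightBulbFibre` (Diff-orbit form:
`∃ φ ∈ Diff(S² × S²), ∃ x, ∀ p, φ (g p) = (x, p)`), which follows from this fact by taking
`Φ₁ = F.toDiffeomorph 1`, observing that `Φ₁ ∘ g : S² → {x₀} × S²` is a smooth embedding of `S²`
into `S²`, hence a diffeomorphism `σ` (invariance of domain / compactness), and setting
`φ := (id × σ⁻¹) ∘ Φ₁` — elementary but not part of the printed theorem.

## References

* D. Gabai, *The 4-dimensional light bulb theorem*, JAMS 33 (2020), Thm. 1.9 (p. 3 of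
  arXiv:1705.09989v2; = Thm. 10.8). [Gabai2020] (held: `paper:arxiv-1705.09989`, read p. 3, 23)
* R. A. Litherland, *Symmetries of twist-spun knots* / the `S² × Sᵐ` light bulb theorem (1985),
  cited as [Li] in Gabai2020.
-/

noncomputable section

open scoped Manifold ContDiff
open Set Function

namespace Literature.Topology.FourManifolds

/-- The round 2-sphere `S² ⊂ ℝ³` with Mathlib's smooth structure (model `𝓡 2`). -/
local notation "𝕊²" => (Metric.sphere (0 : EuclideanSpace ℝ (Fin 3)) 1)

/-- **Gabai 2020, Theorem 1.9 (4D light bulb theorem in `S² × S²`), set form.** "If `R` is an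
embedded 2-sphere in `S² × S²`, homologous to `x₀ × S²`, that intersects `S² × y₀` transversely
and only at the point `(x₀, y₀)`, then `R` is isotopic to `x₀ × S²` via an isotopy fixing
`S² × y₀` pointwise." Here `R = range g` for a `C^∞` embedding `g : S² → S² × S²` (product
structure `(𝓡 2).prod (𝓡 2)`) homotopic to a fibre inclusion `p ↦ (x, p)` (stronger than
"homologous"); the intersection hypothesis is `∃! p₀, (g p₀).2 = y₀` with `d(pr₂ ∘ g)(p₀)` onto;
the conclusion gives an ambient isotopy `F` of `S² × S²` (tree structure `AmbientIsotopy`) with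
`F 1 '' R = {(g p₀).1} × S²` and `F t` fixing `S² × {y₀}` pointwise for every `t`. A named fact
(D-0014), NOT asserted; users take `(h : Gabai2020_thm_1_9_lightBulb)`. Grounds
`Summit.SmoothPoincare4.SmoothPoincare4.Theses.ThreeFibres.LightBulbFibre` (its Diff-orbit form
follows by `φ := (id × σ⁻¹) ∘ F 1`, `σ := pr₂ ∘ F 1 ∘ g ∈ Diff(S²)`, an elementary step not in
the printed theorem). [cite: Gabai2020, Thm. 1.9 (= Thm. 10.8)] -/
def Gabai2020_thm_1_9_lightBulb : Prop :=
  ∀ (g : 𝕊² → 𝕊² × 𝕊²), Manifold.IsSmoothEmbedding (𝓡 2) ((𝓡 2).prod (𝓡 2)) ∞ g →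
    (∃ (x : 𝕊²) (F G : C(𝕊², 𝕊² × 𝕊²)), ⇑F = g ∧ ⇑G = (fun p => (x, p)) ∧ F.Homotopic G) →
    ∀ (y₀ : 𝕊²) (p₀ : 𝕊²), (g p₀).2 = y₀ → (∀ p, (g p).2 = y₀ → p = p₀) →
      Surjective ⇑(mfderiv (𝓡 2) (𝓡 2) (fun q => (g q).2) p₀) →
      ∃ F : AmbientIsotopy ((𝓡 2).prod (𝓡 2)) (𝕊² × 𝕊²),
        F.toFun 1 '' range g = range (fun p : 𝕊² => ((g p₀).1, p)) ∧
        ∀ (t : ℝ) (z : 𝕊²), F.toFun t (z, y₀) = (z, y₀)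

end Literature.Topology.FourManifolds


/-! ## The Diff-orbit corollary consumed by route `SmoothPoincare4/ThreeFibres` -/

namespace Literature.Topology.FourManifolds

/-- The round 2-sphere `S² ⊂ ℝ³` (model `𝓡 2`). -/
local notation "𝕊²" => (Metric.sphere (0 : EuclideanSpace ℝ (Fin 3)) 1)

/-- **Diff-orbit form of Gabai's light bulb theorem** (corollary of the named fact
`Gabai2020_thm_1_9_lightBulb`, in the exact shape of the route item
`Summit.SmoothPoincare4.SmoothPoincare4.Theses.ThreeFibres.LightBulbFibre`): a `C^∞` embedded
sphere `g : S² → S² × S²`, homotopic to a fibre inclusion and having a transverse sphere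
`S² × {y}` met exactly once, is carried by a diffeomorphism `φ` of `S² × S²` *exactly* onto a
fibre inclusion, `φ (g p) = (x, p)` for all `p`. Proof (the elementary step NOT in the printed
theorem, recorded in the docstring of the fact): Gabai's Thm. 1.9 gives an ambient isotopy `F` with
`F₁(range g) = {x₀} × S²`, `x₀ = (g p₀).1`; put `Φ := F.toDiffeomorph 1` and
`σ := pr₂ ∘ Φ ∘ g : S² → S²`. Then `Φ (g p) = (x₀, σ p)`; `σ` is smooth, and its inverse
`τ = g⁻¹ ∘ Φ⁻¹ ∘ (x₀, ·)` is smooth by the universal property of the embedding `g` (Lee,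
*Introduction to Smooth Manifolds*, Cor. 5.30, tree lemma
`Literature.Geometry.Manifold.exists_contMDiff_comp_eq_of_range_subset`), so `σ ∈ Diff(S²)` and
`φ := (id × σ⁻¹) ∘ Φ` works. The homotopy and transversality data are only passed on to the fact.
[cite: Gabai2020, Thm. 1.9 (= Thm. 10.8)] [cite: LeeSmoothManifolds2013, Cor. 5.30] -/
theorem Gabai2020_thm_1_9_lightBulb.diffOrbit (h : Gabai2020_thm_1_9_lightBulb) :
    ∀ g : 𝕊² → 𝕊² × 𝕊², Manifold.IsSmoothEmbedding (𝓡 2) ((𝓡 2).prod (𝓡 2)) ∞ g →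
      (∃ (x : 𝕊²) (F G : C(𝕊², 𝕊² × 𝕊²)), ⇑F = g ∧ ⇑G = (fun p => (x, p)) ∧ F.Homotopic G) →
      (∃ y : 𝕊², (∃! p : 𝕊², (g p).2 = y) ∧
        ∀ p : 𝕊², (g p).2 = y → Surjective ⇑(mfderiv (𝓡 2) (𝓡 2) (fun q => (g q).2) p)) →
      ∃ (φ : (𝕊² × 𝕊²) ≃ₘ⟮(𝓡 2).prod (𝓡 2), (𝓡 2).prod (𝓡 2)⟯ (𝕊² × 𝕊²)) (x : 𝕊²),
        ∀ p, φ (g p) = (x, p) := by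
  intro g hg hhom hdual
  obtain ⟨y₀, ⟨p₀, hp₀, huniq⟩, hsurj⟩ := hdual
  obtain ⟨F, hF1, -⟩ := h g hg hhom y₀ p₀ hp₀ (fun p hp => huniq p hp) (hsurj p₀ hp₀)
  -- the stage-one diffeomorphism and the first coordinate of the target fibre
  set Φ : (𝕊² × 𝕊²) ≃ₘ^∞⟮(𝓡 2).prod (𝓡 2), (𝓡 2).prod (𝓡 2)⟯ (𝕊² × 𝕊²) := F.toDiffeomorph 1
    with hΦdef
  set x₀ : 𝕊² := (g p₀).1 with hx₀def
  have hΦcoe : ⇑Φ = F.toFun 1 := F.coe_toDiffeomorph 1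
  have hrange : range (⇑Φ ∘ g) = range (fun p : 𝕊² => (x₀, p)) := by
    rw [Set.range_comp, hΦcoe, hF1]
  -- `Φ ∘ g` lands in the fibre `{x₀} × S²`: `Φ (g p) = (x₀, σ p)` with `σ := pr₂ ∘ Φ ∘ g`
  have hfst : ∀ p, (Φ (g p)).1 = x₀ := by
    intro p
    have hp : Φ (g p) ∈ range (fun q : 𝕊² => (x₀, q)) := hrange ▸ mem_range_self (f := ⇑Φ ∘ g) p
    obtain ⟨q, hq⟩ := hp
    rw [← hq]
  set σ : 𝕊² → 𝕊² := fun p => (Φ (g p)).2 with hσdef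
  have hΦg : ∀ p, Φ (g p) = (x₀, σ p) := fun p => Prod.ext (hfst p) rfl
  have hσ : ContMDiff (𝓡 2) (𝓡 2) ∞ σ := (Φ.contMDiff.comp hg.contMDiff).snd
  -- the inverse `τ = g⁻¹ ∘ Φ⁻¹ ∘ (x₀, ·)`, smooth by the universal property of the embedding `g`
  have hsub : range (⇑Φ.symm ∘ fun q : 𝕊² => (x₀, q)) ⊆ range g := by
    rintro _ ⟨q, rfl⟩
    have hq : (x₀, q) ∈ range (⇑Φ ∘ g) := hrange ▸ mem_range_self q
    obtain ⟨p, hp⟩ := hq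
    refine ⟨p, ?_⟩
    simp only [comp_apply] at hp ⊢
    rw [← hp, Diffeomorph.symm_apply_apply]
  obtain ⟨τ, hτ, hgτ⟩ := Literature.Geometry.Manifold.exists_contMDiff_comp_eq_of_range_subset hg
    (Φ.symm.contMDiff.comp (contMDiff_const.prodMk contMDiff_id)) hsub
  have hgτ' : ∀ q, g (τ q) = Φ.symm (x₀, q) := fun q => congrFun hgτ q
  have hστ : ∀ q, σ (τ q) = q := by
    intro q
    simp only [hσdef, hgτ', Diffeomorph.apply_symm_apply]
  have hτσ : ∀ p, τ (σ p) = p := by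
    intro p
    apply hg.isEmbedding.injective
    rw [hgτ', ← hΦg, Diffeomorph.symm_apply_apply]
  -- `σ` as a diffeomorphism of `S²`, and `φ := (id × σ⁻¹) ∘ Φ`
  let σ' : 𝕊² ≃ₘ⟮𝓡 2, 𝓡 2⟯ 𝕊² :=
    { toFun := σ
      invFun := τ
      left_inv := hτσ
      right_inv := hστ
      contMDiff_toFun := hσ
      contMDiff_invFun := hτ }
  have hσ'symm : ∀ q, σ'.symm q = τ q := fun _ => rfl
  refine ⟨Φ.trans ((Diffeomorph.refl (𝓡 2) 𝕊² ∞).prodCongr σ'.symm), x₀, fun p => ?_⟩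
  rw [Diffeomorph.coe_trans, comp_apply, hΦg, Diffeomorph.coe_prodCongr, Prod.map_apply,
    Diffeomorph.coe_refl, id, hσ'symm, hτσ]

end Literature.Topology.FourManifolds

end
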